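import Summits.AnomalousDissipation.AnomalousDissipation.Theses.TameRoughRigidity
import Summits.AnomalousDissipation.AnomalousDissipation.Theorems.GPStatisticalRigidity.Negative.LoadBearing
import Summits.AnomalousDissipation.AnomalousDissipation.Theorems.EnsembleRigidityGPStatisticalRigidityDesaturation
import Summits.AnomalousDissipation.AnomalousDissipation.Theorems.TameRoughRigidityTameToRoughWitnessParityTools
import Summits.AnomalousDissipation.AnomalousDissipation.Theorems.TameRoughRigidityTameToRoughWitnessBumpTools
import Literature.Analysis.FluidPDE.CylindricalGenerator
import HarnessLib

/-!
# Witness form of `TameRoughRigidity.TameToRough` (stmt-AnomalousDissipation-18401) — the two steps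

Lead prover of the crux R = `TameToRough` (conditional Onsager calibration), line `Sketch`
(card `Cruxes/TameToRough/Ideas/cosigned-flux-witness.md`). Support file for
`Theorems/TameRoughRigidityTameToRoughWitnessForm.lean`, which proves that the line's open stub S2
(`stub_coSignedFloor`: odd-weighted PRODUCT witnesses on even measures) is a restatement of the crux. The two
steps of the construction "target X ⇒ S2" live here:

* `witnessForm_oddBeat` — on an EVEN measure (`T_*μ = μ`, `T v = −v`) with some defect constant, if a cylindrical
  test `Θ` beats a constant `D ≥ 0` (`D‖∇Θ'‖_{L²(μ;L²)} < |∫⟨F₀,Θ'⟩ dμ|`) then so does the test with the ODD PART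
  `θₒ(c) = ½(θ(c) − θ(−c))` of its profile, whose cost is positive: the even part has an odd integrand (zero mean on
  the even measure) and the parallelogram law `‖∇Θ'(v)‖² + ‖∇Θ'(−v)‖² = 2‖∇Θₑ'‖² + 2‖∇Θₒ'‖²` bounds the odd cost by
  the full cost.
* `witnessForm_build` — for an odd, bounded, eventually vanishing profile `θₒ` with positive cost
  `Sₒ = ‖∇Θₒ'‖_{L²(μ;L²)}` and any `λ > 0`, the FAT EVEN BUMP `φ := λK₀ χ` (`K₀ = sup|θₒ| + 1`, `χ ≡ 1` on a ball
  containing `supp θₒ`, `|∇χ| ≤ ε`) and the odd weight `ψ := θₒ/K₀` form a product witness whose budget is EXACTLY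
  `λ ∫⟨F₀, Θₒ'⟩ dμ` (where `ψ ≠ 0` the bump is flat; where the bump bends, `θₒ` and `∇θₒ` vanish) and whose cost is
  `≤ λK₀ε√Γ + λSₒ ≤ 2λSₒ` (`Γ` a Gram constant of the test fields).

Tools: the landed `stub_witnessParityTools` (p161179) and `stub_witnessBumpTools` (p161056). The file ends with the
registered conjunction `stub_witnessFormSteps`.

## References

* C. Foias, O. Manley, R. Rosa, R. Temam, *Navier–Stokes Equations and Turbulence*, CUP (2001), Ch. IV §1.2
  Def. 1.2–1.3. [FoiasManleyRosaTemam2001]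
* `Cruxes/TameToRough/{STRATEGY-CENSUS.md (F2), Lines/Sketch.lean, Ideas/cosigned-flux-witness.md}`.
-/

set_option linter.dupNamespace false

noncomputable section

namespace Summit.AnomalousDissipation.AnomalousDissipation.Theorems.TameRoughRigidity.TameToRough

open MeasureTheory Filter Topology UnitAddTorus
open scoped InnerProductSpace RealInnerProductSpace ENNReal NNReal
open Literature.Analysis.FunctionSpaces Literature.Analysis.FluidPDE
open Summit.AnomalousDissipation.AnomalousDissipation.Theses.TameRoughRigidity
open Summit.AnomalousDissipation.AnomalousDissipation.Theorems.GPStatisticalRigidity.Negative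
open Summit.AnomalousDissipation.AnomalousDissipation.Theorems.EnsembleRigidity.GPStatisticalRigidity

/-- Local notation: real vector fields on `T³`. -/
local notation "Vec3" => (UnitAddTorus (Fin 3)) → (EuclideanSpace ℝ (Fin 3))
/-- Local notation: `L²(T³; ℝ³)`. -/
local notation "L2" => (Lp (EuclideanSpace ℝ (Fin 3)) 2 (volume : Measure (UnitAddTorus (Fin 3))))
/-- Local notation: the energy space `H`. -/
local notation "H3" => (Torus.energySpace (Fin 3))

/-! ### Step 1: an ODD test beating a forbidden defect constant -/

/-- **Odd reduction of a beating test.** On an even measure with defect constant `R`, if a cylindrical test `Θ`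
beats the constant `D ≥ 0` (`D‖∇Θ'‖_{L²(μ;L²)} < |∫⟨F₀,Θ'⟩ dμ|`), then so does the test with the ODD PART of its
profile, whose cost is moreover positive; the odd profile is bounded and vanishes with its derivative outside a
ball. (Even part: odd integrand, zero mean; costs: parallelogram law.) -/
theorem witnessForm_oddBeat (μ : Measure H3) [IsProbabilityMeasure μ]
    (heven : μ.map (fun v : H3 => -v) = μ) {f : Vec3} (hfint : Integrable f volume) {R D : ℝ}
    (hD0 : 0 ≤ D) (hdef : DefectLE f μ R) (Θ : Torus.CylindricalTest (Fin 3))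
    (hΘ : D * Real.sqrt (∫ v, Torus.gradNormSq (Θ.grad v) ∂μ) <
      |∫ v, Torus.nsGeneratorPairing 0 f v (Θ.grad v) ∂μ|) :
    ∃ Θo : Torus.CylindricalTest (Fin 3), (∀ c, Θo.φ (-c) = -Θo.φ c) ∧
      (∃ M : ℝ, 0 ≤ M ∧ ∀ c, |Θo.φ c| ≤ M) ∧
      (∃ ρ : ℝ, 0 < ρ ∧ ∀ c, ρ ≤ ‖c‖ → Θo.φ c = 0 ∧ fderiv ℝ Θo.φ c = 0) ∧
      0 < Real.sqrt (∫ v, Torus.gradNormSq (Θo.grad v) ∂μ) ∧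
      D * Real.sqrt (∫ v, Torus.gradNormSq (Θo.grad v) ∂μ) <
        |∫ v, Torus.nsGeneratorPairing 0 f v (Θo.grad v) ∂μ| := by
  obtain ⟨hA1, hA2, hA3, hA4, -, -, hA7⟩ := stub_witnessParityTools
  obtain ⟨hθo1, hθoc, hsplit, hepar, hopar, ⟨M, hM0, hM⟩, ⟨ρ, hρ, hρ0⟩⟩ :=
    hA7 Θ.m Θ.φ Θ.φ_contDiff Θ.φ_compact
  -- the odd-part test functional (same fields)
  let Θo : Torus.CylindricalTest (Fin 3) :=
    { m := Θ.m, g := Θ.g, g_smooth := Θ.g_smooth, g_divFree := Θ.g_divFree, g_zeroMean := Θ.g_zeroMean,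
      φ := fun c => 2⁻¹ * (Θ.φ c - Θ.φ (-c)), φ_contDiff := hθo1, φ_compact := hθoc }
  have hΘoφ : ∀ c, Θo.φ c = 2⁻¹ * (Θ.φ c - Θ.φ (-c)) := fun c => rfl
  -- coefficient functions and the two halves of the budget
  let a : Fin Θ.m → H3 → ℝ := fun i v =>
    fderiv ℝ (fun c => 2⁻¹ * (Θ.φ c + Θ.φ (-c))) (Θ.coords v) (EuclideanSpace.single i 1)
  let b : Fin Θ.m → H3 → ℝ := fun i v =>
    fderiv ℝ (fun c => 2⁻¹ * (Θ.φ c - Θ.φ (-c))) (Θ.coords v) (EuclideanSpace.single i 1)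
  let N : Fin Θ.m → H3 → ℝ := fun i v => Torus.nsGeneratorPairing 0 f v (Θ.g i)
  let A : H3 → ℝ := fun v => ∑ i, a i v * N i v
  let B : H3 → ℝ := fun v => ∑ i, b i v * N i v
  have hgradΘ : ∀ v : H3, Torus.nsGeneratorPairing 0 f v (Θ.grad v) = A v + B v := fun v => by
    rw [Torus.nsGeneratorPairing_grad 0 hfint Θ v]
    show _ = (∑ i, a i v * N i v) + ∑ i, b i v * N i v
    rw [← Finset.sum_add_distrib]
    refine Finset.sum_congr rfl fun i _ => ?_
    rw [hsplit]; ring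
  have hgradΘo : ∀ v : H3, Torus.nsGeneratorPairing 0 f v (Θo.grad v) = B v := fun v =>
    Torus.nsGeneratorPairing_grad 0 hfint Θo v
  -- `A` is odd, hence integrates to zero on the even measure
  have hAodd : ∀ v : H3, A (-v) = -A v := fun v => by
    show (∑ i, a i (-v) * N i (-v)) = -∑ i, a i v * N i v
    rw [← Finset.sum_neg_distrib]
    refine Finset.sum_congr rfl fun i _ => ?_
    show fderiv ℝ (fun c => 2⁻¹ * (Θ.φ c + Θ.φ (-c))) (Θ.coords (-v)) (EuclideanSpace.single i 1) *
        Torus.nsGeneratorPairing 0 f (-v) (Θ.g i) =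
      -(fderiv ℝ (fun c => 2⁻¹ * (Θ.φ c + Θ.φ (-c))) (Θ.coords v) (EuclideanSpace.single i 1) *
        Torus.nsGeneratorPairing 0 f v (Θ.g i))
    rw [hA3 Θ v, hepar, desaturation_generator_neg_left]; ring
  have hIB : Integrable B μ := by
    have h := (hdef Θo).1
    have hfun : (fun v : H3 => Torus.nsGeneratorPairing 0 f v (Θo.grad v)) = B := funext hgradΘo
    rwa [hfun] at h
  have hIA : Integrable A μ := by
    refine (((hdef Θ).1).sub hIB).congr (Filter.Eventually.of_forall fun v => ?_)
    show Torus.nsGeneratorPairing 0 f v (Θ.grad v) - B v = A v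
    rw [hgradΘ]; ring
  have hA0 : ∫ v, A v ∂μ = 0 := by
    have h1 := hA1 μ heven A
    have h2 : (fun v : H3 => A (-v)) = fun v => -A v := funext hAodd
    rw [h2, integral_neg] at h1
    linarith
  have hbudget : ∫ v, Torus.nsGeneratorPairing 0 f v (Θ.grad v) ∂μ =
      ∫ v, Torus.nsGeneratorPairing 0 f v (Θo.grad v) ∂μ := by
    rw [integral_congr_ae (Filter.Eventually.of_forall hgradΘ), integral_add hIA hIB, hA0, zero_add,
      integral_congr_ae (Filter.Eventually.of_forall hgradΘo)]
  -- costs: parallelogram law on the even measure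
  have hgv : ∀ v : H3, Θ.grad v = fun x => ∑ i, (a i v + b i v) • Θ.g i x := fun v => by
    funext x
    show (∑ i, fderiv ℝ Θ.φ (Θ.coords v) (EuclideanSpace.single i 1) • Θ.g i x) = _
    exact Finset.sum_congr rfl fun i _ => by rw [hsplit]
  have hgnv : ∀ v : H3, Θ.grad (-v) = fun x => ∑ i, (-a i v + b i v) • Θ.g i x := fun v => by
    funext x
    show (∑ i, fderiv ℝ Θ.φ (Θ.coords (-v)) (EuclideanSpace.single i 1) • Θ.g i x) = _
    refine Finset.sum_congr rfl fun i _ => ?_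
    rw [hsplit, hA3 Θ v, hepar, hopar]
  have hgov : ∀ v : H3, Θo.grad v = fun x => ∑ i, b i v • Θ.g i x := fun v => rfl
  have hpar : ∀ v : H3, 2 * Torus.gradNormSq (Θo.grad v) ≤
      Torus.gradNormSq (Θ.grad v) + Torus.gradNormSq (Θ.grad (-v)) := fun v => by
    rw [hgv, hgnv, hgov, hA4 Θ.m Θ.g Θ.g_smooth (fun i => a i v) (fun i => b i v)]
    linarith [Torus.gradNormSq_nonneg (fun x => ∑ i, a i v • Θ.g i x)]
  have hIgΘ : Integrable (fun v : H3 => Torus.gradNormSq (Θ.grad v)) μ :=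
    desaturation_integrable_testEnstrophy Θ μ
  have hIgΘn : Integrable (fun v : H3 => Torus.gradNormSq (Θ.grad (-v))) μ :=
    hA2 μ heven (fun v => Torus.gradNormSq (Θ.grad v)) hIgΘ
  have hIgΘo : Integrable (fun v : H3 => Torus.gradNormSq (Θo.grad v)) μ :=
    desaturation_integrable_testEnstrophy Θo μ
  have hSo_le : ∫ v, Torus.gradNormSq (Θo.grad v) ∂μ ≤ ∫ v, Torus.gradNormSq (Θ.grad v) ∂μ := by
    have h1 : ∫ v, 2 * Torus.gradNormSq (Θo.grad v) ∂μ ≤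
        ∫ v, (Torus.gradNormSq (Θ.grad v) + Torus.gradNormSq (Θ.grad (-v))) ∂μ :=
      integral_mono (hIgΘo.const_mul 2) (hIgΘ.add hIgΘn) hpar
    rw [integral_const_mul, integral_add hIgΘ hIgΘn,
      hA1 μ heven (fun v => Torus.gradNormSq (Θ.grad v))] at h1
    linarith
  have hSo0 : 0 ≤ Real.sqrt (∫ v, Torus.gradNormSq (Θo.grad v) ∂μ) := Real.sqrt_nonneg _
  have hSoS : Real.sqrt (∫ v, Torus.gradNormSq (Θo.grad v) ∂μ) ≤
      Real.sqrt (∫ v, Torus.gradNormSq (Θ.grad v) ∂μ) := Real.sqrt_le_sqrt hSo_le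
  have hBgt : D * Real.sqrt (∫ v, Torus.gradNormSq (Θo.grad v) ∂μ) <
      |∫ v, Torus.nsGeneratorPairing 0 f v (Θo.grad v) ∂μ| := by
    rw [← hbudget]
    exact lt_of_le_of_lt (mul_le_mul_of_nonneg_left hSoS hD0) hΘ
  have hSopos : 0 < Real.sqrt (∫ v, Torus.gradNormSq (Θo.grad v) ∂μ) := by
    rcases hSo0.lt_or_eq with h | h
    · exact h
    · exfalso
      have h2 := (hdef Θo).2
      rw [← h, mul_zero] at h2
      rw [← h, mul_zero] at hBgt
      linarith
  refine ⟨Θo, fun c => ?_, ⟨M, hM0, fun c => ?_⟩, ⟨ρ, hρ, fun c hc => ?_⟩, hSopos, hBgt⟩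
  · rw [hΘoφ, hΘoφ, neg_neg]; ring
  · rw [hΘoφ]; exact hM c
  · exact hρ0 c hc

/-! ### Step 2: the fat-bump product witness -/

/-- **The product witness.** For an odd, bounded, eventually-vanishing profile `θₒ` with positive cost
`Sₒ = ‖∇Θₒ'‖_{L²(μ;L²)}` and any `λ > 0`: the even profile `φ := λK₀ χ` (`K₀ = sup|θₒ| + 1`, `χ` a wide flat even
bump) and the odd weight `ψ := θₒ/K₀` form a product witness of cost `≤ 2λSₒ` whose budget is exactly
`λ |∫⟨F₀, Θₒ'⟩ dμ|`. -/
theorem witnessForm_build (μ : Measure H3) [IsProbabilityMeasure μ] {f : Vec3} (hfint : Integrable f volume)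
    (Θo : Torus.CylindricalTest (Fin 3)) (hodd : ∀ c, Θo.φ (-c) = -Θo.φ c)
    (hbd : ∃ M : ℝ, 0 ≤ M ∧ ∀ c, |Θo.φ c| ≤ M)
    (hvan : ∃ ρ : ℝ, 0 < ρ ∧ ∀ c, ρ ≤ ‖c‖ → Θo.φ c = 0 ∧ fderiv ℝ Θo.φ c = 0)
    (hSopos : 0 < Real.sqrt (∫ v, Torus.gradNormSq (Θo.grad v) ∂μ)) {lam : ℝ} (hlam : 0 < lam) :
    ∃ (Φ : Torus.CylindricalTest (Fin 3)) (ψ : EuclideanSpace ℝ (Fin Φ.m) → ℝ) (K : ℝ),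
      ContDiff ℝ 1 ψ ∧ HasCompactSupport ψ ∧ (∀ c, |ψ c| ≤ 1) ∧ (∀ c, ψ (-c) = -ψ c) ∧
      (∀ c, Φ.φ (-c) = Φ.φ c) ∧ (∀ c, |Φ.φ c| ≤ K) ∧
      Real.sqrt (∫ v, Torus.gradNormSq (Φ.grad v) ∂μ) +
          K * Real.sqrt (∫ v, Torus.gradNormSq
            (fun x => ∑ i, (fderiv ℝ ψ (Φ.coords v) (EuclideanSpace.single i 1)) • Φ.g i x) ∂μ) ≤
        2 * (lam * Real.sqrt (∫ v, Torus.gradNormSq (Θo.grad v) ∂μ)) ∧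
      |∫ v, (ψ (Φ.coords v) * Torus.nsGeneratorPairing 0 f v (Φ.grad v) +
          Φ.eval v * Torus.nsGeneratorPairing 0 f v
            (fun x => ∑ i, (fderiv ℝ ψ (Φ.coords v) (EuclideanSpace.single i 1)) • Φ.g i x)) ∂μ| =
        lam * |∫ v, Torus.nsGeneratorPairing 0 f v (Θo.grad v) ∂μ| := by
  obtain ⟨-, -, -, -, hA5, hA6, -⟩ := stub_witnessParityTools
  obtain ⟨M, hM0, hM⟩ := hbd
  obtain ⟨ρ, hρ, hρ0⟩ := hvan
  -- constants
  set So : ℝ := Real.sqrt (∫ v, Torus.gradNormSq (Θo.grad v) ∂μ) with hSo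
  have hSo0 : 0 ≤ So := hSopos.le
  set K₀ : ℝ := M + 1 with hK₀
  have hK₀pos : 0 < K₀ := by rw [hK₀]; linarith
  set Γ : ℝ := Θo.m * ∑ i, Torus.gradNormSq (Θo.g i) with hΓ
  have hΓ0 : 0 ≤ Γ :=
    mul_nonneg (Nat.cast_nonneg _) (Finset.sum_nonneg fun i _ => Torus.gradNormSq_nonneg _)
  set ε : ℝ := So / (K₀ * (Real.sqrt Γ + 1)) with hε
  have hεpos : 0 < ε := by rw [hε]; positivity
  obtain ⟨χ, hχ1, hχc, hχeven, hχ01, hχone, hχflat, hχε⟩ :=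
    stub_witnessBumpTools Θo.m (ρ + 1) ε (by linarith) hεpos
  -- the two profiles
  have hφ1 : ContDiff ℝ 1 (fun c => (lam * K₀) * χ c) := contDiff_const.mul hχ1
  have hφc : HasCompactSupport (fun c => (lam * K₀) * χ c) := hχc.mul_left
  let Φ : Torus.CylindricalTest (Fin 3) :=
    { m := Θo.m, g := Θo.g, g_smooth := Θo.g_smooth, g_divFree := Θo.g_divFree, g_zeroMean := Θo.g_zeroMean,
      φ := fun c => (lam * K₀) * χ c, φ_contDiff := hφ1, φ_compact := hφc }
  have hΦφ : ∀ c, Φ.φ c = (lam * K₀) * χ c := fun c => rfl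
  let ψ : EuclideanSpace ℝ (Fin Θo.m) → ℝ := fun c => K₀⁻¹ * Θo.φ c
  have hψdef : ∀ c, ψ c = K₀⁻¹ * Θo.φ c := fun c => rfl
  have hψ1 : ContDiff ℝ 1 ψ := contDiff_const.mul Θo.φ_contDiff
  have hψc : HasCompactSupport ψ := Θo.φ_compact.mul_left
  have hχdiff : Differentiable ℝ χ := hχ1.differentiable one_ne_zero
  have hθodiff : Differentiable ℝ Θo.φ := Θo.φ_contDiff.differentiable one_ne_zero
  have hdφ : ∀ c e, fderiv ℝ Φ.φ c e = (lam * K₀) * fderiv ℝ χ c e := fun c e => by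
    show fderiv ℝ (fun c => (lam * K₀) * χ c) c e = _
    rw [fderiv_const_mul (hχdiff c)]; rfl
  have hdψ : ∀ c e, fderiv ℝ ψ c e = K₀⁻¹ * fderiv ℝ Θo.φ c e := fun c e => by
    show fderiv ℝ (fun c => K₀⁻¹ * Θo.φ c) c e = _
    rw [fderiv_const_mul (hθodiff c)]; rfl
  -- coefficient functions
  let b : Fin Θo.m → H3 → ℝ := fun i v => fderiv ℝ Θo.φ (Θo.coords v) (EuclideanSpace.single i 1)
  let N : Fin Θo.m → H3 → ℝ := fun i v => Torus.nsGeneratorPairing 0 f v (Θo.g i)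
  have hgov : ∀ v : H3, Θo.grad v = fun x => ∑ i, b i v • Θo.g i x := fun v => rfl
  have hgenΘo : ∀ v : H3, Torus.nsGeneratorPairing 0 f v (Θo.grad v) = ∑ i, b i v * N i v := fun v =>
    Torus.nsGeneratorPairing_grad 0 hfint Θo v
  have hlamK : 0 ≤ lam * K₀ := mul_nonneg hlam.le hK₀pos.le
  refine ⟨Φ, ψ, lam * K₀, hψ1, hψc, fun c => ?_, fun c => ?_, fun c => ?_, fun c => ?_, ?_, ?_⟩
  · -- `|ψ| ≤ 1`
    rw [hψdef, abs_mul, abs_of_pos (inv_pos.2 hK₀pos), inv_mul_le_iff₀ hK₀pos, mul_one]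
    exact (hM c).trans (by rw [hK₀]; linarith)
  · -- `ψ` odd
    rw [hψdef, hψdef, hodd]; ring
  · -- `φ` even
    rw [hΦφ, hΦφ, hχeven]
  · -- `|φ| ≤ λK₀`
    rw [hΦφ, abs_of_nonneg (mul_nonneg hlamK (hχ01 c).1)]
    exact mul_le_of_le_one_right hlamK (hχ01 c).2
  · -- cost `≤ 2λSₒ`
    have hcoefΦ : ∀ (v : H3) (i : Fin Θo.m),
        |fderiv ℝ Φ.φ (Φ.coords v) (EuclideanSpace.single i 1)| ≤ lam * K₀ * ε := fun v i => by
      rw [hdφ, abs_mul, abs_of_nonneg hlamK]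
      exact mul_le_mul_of_nonneg_left (hχε _ i) hlamK
    have hgΦ : ∀ v : H3, Torus.gradNormSq (Φ.grad v) ≤ (lam * K₀ * ε) ^ 2 * Γ := fun v => by
      have h := hA6 Θo.m Θo.g Θo.g_smooth (lam * K₀ * ε)
        (fun i => fderiv ℝ Φ.φ (Φ.coords v) (EuclideanSpace.single i 1)) (hcoefΦ v)
      calc Torus.gradNormSq (Φ.grad v)
          = Torus.gradNormSq (fun x => ∑ i, fderiv ℝ Φ.φ (Φ.coords v) (EuclideanSpace.single i 1) •
              Θo.g i x) := rfl
        _ ≤ Θo.m * (lam * K₀ * ε) ^ 2 * ∑ i, Torus.gradNormSq (Θo.g i) := h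
        _ = (lam * K₀ * ε) ^ 2 * Γ := by rw [hΓ]; ring
    have hIgΦ : Integrable (fun v : H3 => Torus.gradNormSq (Φ.grad v)) μ :=
      desaturation_integrable_testEnstrophy Φ μ
    have hint1 : ∫ v, Torus.gradNormSq (Φ.grad v) ∂μ ≤ (lam * K₀ * ε) ^ 2 * Γ := by
      have h := integral_mono hIgΦ (integrable_const ((lam * K₀ * ε) ^ 2 * Γ)) hgΦ
      simpa only [integral_const, probReal_univ, one_smul] using h
    have hcost1 : Real.sqrt (∫ v, Torus.gradNormSq (Φ.grad v) ∂μ) ≤ lam * So := by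
      have h1 : Real.sqrt (∫ v, Torus.gradNormSq (Φ.grad v) ∂μ) ≤ lam * K₀ * ε * Real.sqrt Γ := by
        calc Real.sqrt (∫ v, Torus.gradNormSq (Φ.grad v) ∂μ)
            ≤ Real.sqrt ((lam * K₀ * ε) ^ 2 * Γ) := Real.sqrt_le_sqrt hint1
          _ = lam * K₀ * ε * Real.sqrt Γ := by
              rw [Real.sqrt_mul (sq_nonneg _), Real.sqrt_sq (by positivity)]
      have h3 : K₀ * ε * Real.sqrt Γ ≤ So := by
        have h4 : K₀ * ε * Real.sqrt Γ = So * (Real.sqrt Γ / (Real.sqrt Γ + 1)) := by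
          rw [hε]; field_simp
        rw [h4]
        have h5 : Real.sqrt Γ / (Real.sqrt Γ + 1) ≤ 1 := by
          rw [div_le_one (by positivity)]; linarith
        exact mul_le_of_le_one_right hSo0 h5
      calc Real.sqrt (∫ v, Torus.gradNormSq (Φ.grad v) ∂μ) ≤ lam * K₀ * ε * Real.sqrt Γ := h1
        _ = lam * (K₀ * ε * Real.sqrt Γ) := by ring
        _ ≤ lam * So := mul_le_mul_of_nonneg_left h3 hlam.le
    -- second term: homogeneity
    have hfieldψ : ∀ v : H3,
        (fun x => ∑ i, (fderiv ℝ ψ (Φ.coords v) (EuclideanSpace.single i 1)) • Φ.g i x) =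
          fun x => ∑ i, (K₀⁻¹ * b i v) • Θo.g i x := fun v => by
      funext x
      refine Finset.sum_congr rfl fun i _ => ?_
      rw [hdψ]; rfl
    have hcost2 : (lam * K₀) * Real.sqrt (∫ v, Torus.gradNormSq
        (fun x => ∑ i, (fderiv ℝ ψ (Φ.coords v) (EuclideanSpace.single i 1)) • Φ.g i x) ∂μ) =
          lam * So := by
      have h1 : ∀ v : H3, Torus.gradNormSq
          (fun x => ∑ i, (fderiv ℝ ψ (Φ.coords v) (EuclideanSpace.single i 1)) • Φ.g i x) =
            (K₀⁻¹) ^ 2 * Torus.gradNormSq (Θo.grad v) := fun v => by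
        rw [hfieldψ v, hA5 Θo.m Θo.g Θo.g_smooth K₀⁻¹ (fun i => b i v), hgov]
      simp_rw [h1]
      rw [integral_const_mul, Real.sqrt_mul (sq_nonneg _), Real.sqrt_sq (inv_pos.2 hK₀pos).le, ← hSo]
      field_simp
    calc Real.sqrt (∫ v, Torus.gradNormSq (Φ.grad v) ∂μ) +
          (lam * K₀) * Real.sqrt (∫ v, Torus.gradNormSq
            (fun x => ∑ i, (fderiv ℝ ψ (Φ.coords v) (EuclideanSpace.single i 1)) • Φ.g i x) ∂μ)
        ≤ lam * So + lam * So := by rw [hcost2]; linarith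
      _ = 2 * (lam * So) := by ring
  · -- budget: the integrand is exactly `λ ⟨F₀, Θₒ'⟩`
    have hgenΦ : ∀ v : H3, Torus.nsGeneratorPairing 0 f v (Φ.grad v) =
        ∑ i, fderiv ℝ Φ.φ (Φ.coords v) (EuclideanSpace.single i 1) * N i v := fun v =>
      Torus.nsGeneratorPairing_grad 0 hfint Φ v
    have hfieldψ : ∀ v : H3,
        (fun x => ∑ i, (fderiv ℝ ψ (Φ.coords v) (EuclideanSpace.single i 1)) • Φ.g i x) =
          fun x => ∑ i, (K₀⁻¹ * b i v) • Θo.g i x := fun v => by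
      funext x
      refine Finset.sum_congr rfl fun i _ => ?_
      rw [hdψ]; rfl
    have hgenψ : ∀ v : H3, Torus.nsGeneratorPairing 0 f v
        (fun x => ∑ i, (fderiv ℝ ψ (Φ.coords v) (EuclideanSpace.single i 1)) • Φ.g i x) =
          ∑ i, (K₀⁻¹ * b i v) * N i v := fun v => by
      rw [hfieldψ v]
      exact Torus.nsGeneratorPairing_sum_smul 0 hfint v Finset.univ (fun i => K₀⁻¹ * b i v)
        (fun i _ => Θo.g_smooth i)
    have hptw : ∀ v : H3,
        ψ (Φ.coords v) * Torus.nsGeneratorPairing 0 f v (Φ.grad v) +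
          Φ.eval v * Torus.nsGeneratorPairing 0 f v
            (fun x => ∑ i, (fderiv ℝ ψ (Φ.coords v) (EuclideanSpace.single i 1)) • Φ.g i x) =
        lam * Torus.nsGeneratorPairing 0 f v (Θo.grad v) := fun v => by
      rw [hgenΦ, hgenψ, hgenΘo]
      have hcoords : Φ.coords v = Θo.coords v := rfl
      have heval : Φ.eval v = lam * K₀ * χ (Θo.coords v) := rfl
      rw [hcoords, heval, hψdef]
      by_cases hcase : ‖Θo.coords v‖ < ρ + 1
      · -- inside: the bump is flat and equal to one
        have hflat : fderiv ℝ χ (Θo.coords v) = 0 := hχflat _ hcase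
        have hone : χ (Θo.coords v) = 1 := hχone _ hcase.le
        have h1 : ∑ i, fderiv ℝ Φ.φ (Θo.coords v) (EuclideanSpace.single i 1) * N i v = 0 :=
          Finset.sum_eq_zero fun i _ => by rw [hdφ, hflat]; simp
        rw [h1, hone, mul_zero, zero_add, mul_one, Finset.mul_sum, Finset.mul_sum]
        refine Finset.sum_congr rfl fun i _ => ?_
        field_simp
      · -- outside: `θₒ` and `Dθₒ` vanish
        have hout : ρ ≤ ‖Θo.coords v‖ := by linarith [not_lt.1 hcase]
        obtain ⟨hθ0, hdθ0⟩ := hρ0 _ hout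
        have hb0 : ∀ i, b i v = 0 := fun i => by
          show fderiv ℝ Θo.φ (Θo.coords v) (EuclideanSpace.single i 1) = 0
          rw [hdθ0]; rfl
        have h2 : ∑ i, (K₀⁻¹ * b i v) * N i v = 0 :=
          Finset.sum_eq_zero fun i _ => by rw [hb0]; ring
        have hB0 : ∑ i, b i v * N i v = 0 := Finset.sum_eq_zero fun i _ => by rw [hb0]; ring
        rw [hθ0, h2, hB0]; ring
    rw [integral_congr_ae (Filter.Eventually.of_forall hptw), integral_const_mul, abs_mul, abs_of_pos hlam]

/-! ### The registered conjunction -/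

/-- **Tools `stub_witnessFormSteps`** — the two steps above, as registered on the crux. [folklore] -/
theorem stub_witnessFormSteps :
    (∀ (μ : Measure H3) [IsProbabilityMeasure μ], μ.map (fun v : H3 => -v) = μ →
      ∀ {f : Vec3}, Integrable f volume → ∀ {R D : ℝ}, 0 ≤ D → DefectLE f μ R →
      ∀ Θ : Torus.CylindricalTest (Fin 3),
        D * Real.sqrt (∫ v, Torus.gradNormSq (Θ.grad v) ∂μ) <
          |∫ v, Torus.nsGeneratorPairing 0 f v (Θ.grad v) ∂μ| →
        ∃ Θo : Torus.CylindricalTest (Fin 3), (∀ c, Θo.φ (-c) = -Θo.φ c) ∧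
          (∃ M : ℝ, 0 ≤ M ∧ ∀ c, |Θo.φ c| ≤ M) ∧
          (∃ ρ : ℝ, 0 < ρ ∧ ∀ c, ρ ≤ ‖c‖ → Θo.φ c = 0 ∧ fderiv ℝ Θo.φ c = 0) ∧
          0 < Real.sqrt (∫ v, Torus.gradNormSq (Θo.grad v) ∂μ) ∧
          D * Real.sqrt (∫ v, Torus.gradNormSq (Θo.grad v) ∂μ) <
            |∫ v, Torus.nsGeneratorPairing 0 f v (Θo.grad v) ∂μ|) ∧
    (∀ (μ : Measure H3) [IsProbabilityMeasure μ] {f : Vec3}, Integrable f volume →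
      ∀ (Θo : Torus.CylindricalTest (Fin 3)), (∀ c, Θo.φ (-c) = -Θo.φ c) →
      (∃ M : ℝ, 0 ≤ M ∧ ∀ c, |Θo.φ c| ≤ M) →
      (∃ ρ : ℝ, 0 < ρ ∧ ∀ c, ρ ≤ ‖c‖ → Θo.φ c = 0 ∧ fderiv ℝ Θo.φ c = 0) →
      0 < Real.sqrt (∫ v, Torus.gradNormSq (Θo.grad v) ∂μ) → ∀ {lam : ℝ}, 0 < lam →
      ∃ (Φ : Torus.CylindricalTest (Fin 3)) (ψ : EuclideanSpace ℝ (Fin Φ.m) → ℝ) (K : ℝ),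
        ContDiff ℝ 1 ψ ∧ HasCompactSupport ψ ∧ (∀ c, |ψ c| ≤ 1) ∧ (∀ c, ψ (-c) = -ψ c) ∧
        (∀ c, Φ.φ (-c) = Φ.φ c) ∧ (∀ c, |Φ.φ c| ≤ K) ∧
        Real.sqrt (∫ v, Torus.gradNormSq (Φ.grad v) ∂μ) +
            K * Real.sqrt (∫ v, Torus.gradNormSq
              (fun x => ∑ i, (fderiv ℝ ψ (Φ.coords v) (EuclideanSpace.single i 1)) • Φ.g i x) ∂μ) ≤
          2 * (lam * Real.sqrt (∫ v, Torus.gradNormSq (Θo.grad v) ∂μ)) ∧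
        |∫ v, (ψ (Φ.coords v) * Torus.nsGeneratorPairing 0 f v (Φ.grad v) +
            Φ.eval v * Torus.nsGeneratorPairing 0 f v
              (fun x => ∑ i, (fderiv ℝ ψ (Φ.coords v) (EuclideanSpace.single i 1)) • Φ.g i x)) ∂μ| =
          lam * |∫ v, Torus.nsGeneratorPairing 0 f v (Θo.grad v) ∂μ|) :=
  ⟨@witnessForm_oddBeat, @witnessForm_build⟩

end Summit.AnomalousDissipation.AnomalousDissipation.Theorems.TameRoughRigidity.TameToRough

end
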